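import Literature.Probability.LatticeModels.ScaleFrameQuasiMultGlue
import Literature.Probability.LatticeModels.ScaleFrameDatumDecomp
import Literature.Probability.LatticeModels.RandomClusterBlobPushing
import Literature.Probability.LatticeModels.RandomClusterBoundaryPushingTools
import Literature.Probability.LatticeModels.RandomClusterRegionToAnnulus
import Literature.Probability.LatticeModels.FKIsingAnnulusCrossingProofs
import HarnessLib

/-!
# Quasi-multiplicativity on a scale frame: the two arm factors (Kesten 1986, eq. (29)) (proved)

Topic `Literature/Probability/LatticeModels` (trunk `StatMech`, family `crit-ising`). The arm half of
the LOWER bound in Kesten's quasi-multiplicativity (H. Kesten, PTRF 73 (1986), §2, eqs. (29)–(30)) on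
an abstract `ScaleFrame` carrying the no-crossing bounds of an RSW ladder. Let `ν` be the
random-cluster measure of the frame edges inside a vertex set `W` (good vertices of radius `< aM^15`,
containing the band `a < rad < aM^14`) wired on `R' ∪ Y` (`R'` of radius `≤ a`, `Y` of radius
`> aM^14 - η`).

* `rcMeasure_real_sub_isolated_le` — the `B₀`-wired measure of a sub-edge-set is dominated on
  increasing events by the ambient measure wired on `B₀ ∪ I`, `I` isolated in the sub-edge-set;
* `ScaleFrame.arm_inner_lower` — `c · g₁ ≤ ν(R' ↔ {rad ≥ aM^3} inside U₁)`, `U₁ = W ∩ {rad < aM^6}`,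
  `g₁` the same arm probability for the edges inside `U₁` with the layer `{rad ≥ aM^6 - η}` wired to
  `R'`: boundary pushing (A⁺) (`rcMeasure_real_wired_le_free_of_radialBound'`) at the collar
  `(aM^4, aM^5)`, the arm being read inside the core `{rad ≤ aM^4}` (first-hit argument);
* `ScaleFrame.arm_outer_lower` — the mirror image `c · g₂ ≤ ν({rad ≤ aM^11} ↔ Y inside U₂)`,
  `U₂ = W ∩ {rad > aM^8}`, collar `(aM^9, aM^10)`, core `{rad ≥ aM^10}` (collar crossings reversed).

Everything is proved; no definitions.

## References
* [Kesten1986] H. Kesten, Probab. Theory Related Fields 73 (1986) 369–394, §2 eqs. (28)–(30).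
* [BasuSapozhnikov2017ECP] D. Basu, A. Sapozhnikov, ECP 22 (2017) no. 26, §§2, 5.
* G. Grimmett, *The Random-Cluster Model*, Springer (2006): Lemma (4.14).
-/

noncomputable section

open MeasureTheory Finset SimpleGraph
open Literature.Probability.Percolation (BondConfig openConnIn openCrossing isUpperSet_openCrossing)

namespace Literature.Probability.LatticeModels

variable {V : Type*} [Fintype V] [DecidableEq V]

/-! ### Tools -/

section Tools

/-- **The `B₀`-wired measure of a sub-edge-set is dominated on increasing events by the ambient
measure wired on `B₀ ∪ I`, `I` isolated in the sub-edge-set** (`q ≥ 1`, `p < 1`): wiring isolated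
vertices is free of charge (`rcMeasure_real_union_isolated`), then `rcMeasure_fromEdgeSet_real_le`.
[cite: Grimmett2006, Lemma (4.14)] -/
theorem rcMeasure_real_sub_isolated_le {p q : ℝ} (hp : p ∈ Set.Ico (0 : ℝ) 1) (hq : 1 ≤ q)
    {EW E' : Finset (Sym2 V)} (hE : E' ⊆ EW) (B₀ : Set V) (I : Finset V)
    (hI : ∀ v ∈ I, ∀ w, ¬ (fromEdgeSet (E' : Set (Sym2 V))).Adj v w) {A : Set (BondConfig V)}
    (hA : IsUpperSet A) :
    (rcMeasure (fromEdgeSet (E' : Set (Sym2 V))) p q B₀).real A ≤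
      (rcMeasure (fromEdgeSet (EW : Set (Sym2 V))) p q (B₀ ∪ ↑I)).real A := by
  have hp' : p ∈ Set.Icc (0 : ℝ) 1 := ⟨hp.1, hp.2.le⟩
  have hq0 : 0 < q := one_pos.trans_le hq
  haveI := isProbabilityMeasure_rcMeasure (fromEdgeSet (EW : Set (Sym2 V))) hp' hq0 (B₀ ∪ ↑I)
  have hU : ∀ i : Fintype (fromEdgeSet (EW : Set (Sym2 V))).edgeSet,
      E'.filter (fun e => ¬ e.IsDiag) ⊆ @edgeFinset V (fromEdgeSet (EW : Set (Sym2 V))) i :=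
    fun i e he => by
      rw [Finset.mem_filter] at he
      exact (mem_edgeFinset_fromEdgeSet_iff EW i e).2 ⟨hE he.1, he.2⟩
  calc (rcMeasure (fromEdgeSet (E' : Set (Sym2 V))) p q B₀).real A
      = (rcMeasure (fromEdgeSet (E' : Set (Sym2 V))) p q (B₀ ∪ ↑I)).real A :=
        (rcMeasure_real_union_isolated _ hp' hq0 B₀ I hI A).symm
    _ = (rcMeasure (fromEdgeSet (↑(E'.filter fun e => ¬ e.IsDiag) : Set (Sym2 V))) p q
          (B₀ ∪ ↑I)).real A := by
        rw [rcMeasure_congr_graph (fromEdgeSet_coe_filter_not_isDiag E') p q (B₀ ∪ ↑I)]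
    _ ≤ (rcMeasure (fromEdgeSet (EW : Set (Sym2 V))) p q (B₀ ∪ ↑I)).real
          {ω | ω ∩ ↑(E'.filter fun e => ¬ e.IsDiag) ∈ A} :=
        rcMeasure_fromEdgeSet_real_le _ hp' hq _ _ (hU _)
          (rcMeasure_real_cylinder_empty_pos _ hp' hp.2 hq0 _ _) hA
    _ ≤ (rcMeasure (fromEdgeSet (EW : Set (Sym2 V))) p q (B₀ ∪ ↑I)).real A :=
        measureReal_mono fun ω hω => hA Set.inter_subset_left hω

/-- Geometric scales: `4 aM^k ≤ aM^{k+1}` and monotonicity, for `a > 0`, `M ≥ 4`. [folklore] -/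
theorem ScaleFrame.quasiMult_scales {a M : ℝ} (ha : 0 < a) (hM : 4 ≤ M) :
    (∀ k : ℕ, 4 * (a * M ^ k) ≤ a * M ^ (k + 1)) ∧ (∀ k : ℕ, a ≤ a * M ^ k) ∧
      ∀ k l : ℕ, k ≤ l → a * M ^ k ≤ a * M ^ l := by
  have hM1 : (1 : ℝ) ≤ M := by linarith
  refine ⟨fun k => ?_, fun k => le_mul_of_one_le_right ha.le (one_le_pow₀ hM1),
    fun k l hkl => mul_le_mul_of_nonneg_left (pow_le_pow_right₀ hM1 hkl) ha.le⟩
  have h0 : 0 ≤ a * M ^ k := by positivity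
  calc 4 * (a * M ^ k) = a * M ^ k * 4 := by ring
    _ ≤ a * M ^ k * M := mul_le_mul_of_nonneg_left hM h0
    _ = a * M ^ (k + 1) := by ring

end Tools

namespace ScaleFrame

variable (F : ScaleFrame V)

/-! ### Frame bookkeeping -/

/-- `edgesWithin` is monotone. [cite: BasuSapozhnikov2017ECP, §2] -/
theorem edgesWithin_mono {A B : Set V} (h : A ⊆ B) : F.edgesWithin A ⊆ F.edgesWithin B :=
  fun _ he => F.mem_edgesWithin.2 ⟨(F.mem_edgesWithin.1 he).1, fun x hx => h ((F.mem_edgesWithin.1 he).2 x hx)⟩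

/-- An endpoint of a frame edge touching the annulus `(s, s')`, `s' ≤ Rmax`, is good with radius in
`(s - η, s' + η)` (frame continuity). [cite: Kesten1986, §2] -/
theorem rad_of_mem_edgesTouching_annSet {s s' : ℝ} (hs' : s' ≤ F.Rmax) {e : Sym2 V}
    (he : e ∈ F.edgesTouching (F.annSet s s')) {x : V} (hx : x ∈ e) :
    x ∈ F.good ∧ s - F.η < F.rad x ∧ F.rad x < s' + F.η := by
  obtain ⟨heE, v, hv, hvg, hv1, hv2⟩ := F.mem_edgesTouching.1 he
  obtain ⟨hxg, hxr⟩ := F.adj_good e heE v hv x hx hvg (hv2.trans_le hs')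
  obtain ⟨h1, h2⟩ := abs_lt.1 hxr
  exact ⟨hxg, by linarith, by linarith⟩

/-- Along a frame edge from a good vertex of radius `< Rmax` the radius moves by less than `η`.
[cite: Kesten1986, §2] -/
theorem rad_of_adj {e : Sym2 V} (he : e ∈ F.E) {u x : V} (hu : u ∈ e) (hx : x ∈ e)
    (hug : u ∈ F.good) (huR : F.rad u < F.Rmax) :
    x ∈ F.good ∧ F.rad u - F.η < F.rad x ∧ F.rad x < F.rad u + F.η := by
  obtain ⟨hxg, hxr⟩ := F.adj_good e he u hu x hx hug huR
  obtain ⟨h1, h2⟩ := abs_lt.1 hxr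
  exact ⟨hxg, by linarith, by linarith⟩

/-! ### The two arms: boundary pushing (A⁺) -/

/-- **Inner arm.** Under the no-crossing bound of the collar `(aM^4, aM^5)`, the inner arm event
`A₁ = {R' ↔ rad ≥ aM^3 inside U₁}`, `U₁ = W ∩ {rad < aM^6}`, satisfies `c · g₁ ≤ ν(A₁)` where `g₁`
is its probability for the edges inside `U₁` with `R'` and the layer `{rad ≥ aM^6 - η}` wired
together and `ν` is the measure of the edges inside `W` wired on `R' ∪ Y`: boundary pushing (A⁺)
removes the layer from the wiring (the arm is read inside the core `{rad ≤ aM^4}` on lattice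
configurations), `Y` is isolated in `⟨U₁⟩`, and the sub-region measure is dominated by `ν`.
[cite: Kesten1986, §2 eqs. (29)–(30)] -/
theorem arm_inner_lower {p q c a M : ℝ} (hp : p ∈ Set.Ico (0 : ℝ) 1) (hq : 1 ≤ q) (hc : 0 < c)
    (ha : 0 < a) (hM : 4 ≤ M) (hRm : a * M ^ 15 ≤ F.Rmax) (hη : F.η ≤ a)
    (hNC : F.NoCrossBound p q c (a * M ^ 4) (a * M ^ 5)) {W R' Y : Set V}
    (hW : ∀ v ∈ W, v ∈ F.good ∧ F.rad v < a * M ^ 15) (hR'W : R' ⊆ W)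
    (hband : ∀ v : V, v ∈ F.good → a < F.rad v → F.rad v < a * M ^ 14 → v ∈ W)
    (hR' : ∀ v ∈ R', F.rad v ≤ a) (hY : ∀ v ∈ Y, a * M ^ 14 - F.η < F.rad v) :
    c * (rcMeasure (fromEdgeSet (↑(F.edgesWithin (W ∩ {v | F.rad v < a * M ^ 6})) : Set (Sym2 V)))
        p q (R' ∪ {v | a * M ^ 6 - F.η ≤ F.rad v})).real
        (openCrossing (W ∩ {v | F.rad v < a * M ^ 6}) R'
          ((W ∩ {v | F.rad v < a * M ^ 6}) ∩ {v | a * M ^ 3 ≤ F.rad v})) ≤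
      (rcMeasure (fromEdgeSet (↑(F.edgesWithin W) : Set (Sym2 V))) p q (R' ∪ Y)).real
        (openCrossing (W ∩ {v | F.rad v < a * M ^ 6}) R'
          ((W ∩ {v | F.rad v < a * M ^ 6}) ∩ {v | a * M ^ 3 ≤ F.rad v})) := by
  obtain ⟨hstep, hak, hmono⟩ := quasiMult_scales ha hM
  have hp' : p ∈ Set.Icc (0 : ℝ) 1 := ⟨hp.1, hp.2.le⟩
  have hq0 : 0 < q := one_pos.trans_le hq
  have hη0 := F.η_pos
  have s3 : 4 * (a * M ^ 3) ≤ a * M ^ 4 := hstep 3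
  have s4 : 4 * (a * M ^ 4) ≤ a * M ^ 5 := hstep 4
  have s5 : 4 * (a * M ^ 5) ≤ a * M ^ 6 := hstep 5
  have s13 : 4 * (a * M ^ 13) ≤ a * M ^ 14 := hstep 13
  have m3 := hak 3
  have m6_13 := hmono 6 13 (by norm_num)
  have m5_15 := hmono 5 15 (by norm_num)
  set U₁ : Set V := W ∩ {v | F.rad v < a * M ^ 6} with hU₁
  set C₁ : Set V := U₁ ∩ {v | F.rad v ≤ a * M ^ 4} with hC₁
  set Ann : Set V := F.annSet (a * M ^ 4) (a * M ^ 5) with hAnn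
  set L₁ : Set V := {v | a * M ^ 6 - F.η ≤ F.rad v} with hL₁
  set E₁ : Finset (Sym2 V) := F.edgesWithin U₁ with hE₁
  set Q : Set V := {v | a * M ^ 3 ≤ F.rad v} with hQ
  set I₁ : Set (BondConfig V) := {ω | ω ∩ ↑(F.edgesWithin C₁) ∈ openCrossing C₁ R' (C₁ ∩ Q)}
    with hI₁
  have hU₁W : U₁ ⊆ W := Set.inter_subset_left
  have hU₁g : ∀ u ∈ U₁, u ∈ F.good := fun u hu => (hW u hu.1).1
  have hU₁R : ∀ u ∈ U₁, F.rad u < F.Rmax := fun u hu => (hW u hu.1).2.trans_le hRm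
  have hE₁' : ∀ e ∈ E₁, e ∈ F.E ∧ ∀ x ∈ e, x ∈ U₁ := fun e he => F.mem_edgesWithin.1 he
  have hR'C : R' ⊆ C₁ := fun r hr =>
    ⟨⟨hR'W hr, show F.rad r < a * M ^ 6 by linarith [hR' r hr, hak 6, s5, hak 5]⟩,
      show F.rad r ≤ a * M ^ 4 by linarith [hR' r hr, hak 4]⟩
  -- hypotheses of (A⁺)
  have hCA : ∀ v ∈ C₁, v ∉ Ann := fun v hv hvA => absurd hv.2 (not_le.2 hvA.2.1)
  have hLCA : ∀ w ∈ L₁, w ∉ C₁ ∧ w ∉ Ann := fun w hw =>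
    ⟨fun h => by have h1 : F.rad w ≤ a * M ^ 4 := h.2; have h2 : a * M ^ 6 - F.η ≤ F.rad w := hw
                 linarith,
     fun h => by have h1 := h.2.2; have h2 : a * M ^ 6 - F.η ≤ F.rad w := hw; linarith⟩
  have hcore : ∀ e ∈ E₁, (∃ v ∈ C₁, v ∈ e) → ∀ x ∈ e, x ∈ C₁ ∨ x ∈ Ann := by
    rintro e he ⟨v, hv, hve⟩ x hx
    obtain ⟨heE, heU⟩ := hE₁' e he
    obtain ⟨hxg, -, hx2⟩ := F.rad_of_adj heE hve hx (hU₁g v hv.1) (hU₁R v hv.1)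
    have hv4 : F.rad v ≤ a * M ^ 4 := hv.2
    by_cases hx4 : F.rad x ≤ a * M ^ 4
    · exact Or.inl ⟨heU x hx, hx4⟩
    · exact Or.inr ⟨hxg, not_le.1 hx4, by linarith⟩
  have hEA : ∀ e, e ∈ F.edgesTouching Ann ↔ e ∈ E₁ ∧ ∃ v ∈ Ann, v ∈ e := by
    intro e
    constructor
    · intro he
      have he' := he
      obtain ⟨heE, v, hve, hvA⟩ := F.mem_edgesTouching.1 he'
      refine ⟨F.mem_edgesWithin.2 ⟨heE, fun x hx => ?_⟩, v, hvA, hve⟩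
      obtain ⟨hxg, hx1, hx2⟩ := F.rad_of_mem_edgesTouching_annSet (m5_15.trans hRm) he hx
      exact ⟨hband x hxg (by linarith) (by linarith), show F.rad x < a * M ^ 6 by linarith⟩
    · rintro ⟨he, v, hvA, hve⟩
      exact F.mem_edgesTouching.2 ⟨(hE₁' e he).1, v, hve, hvA⟩
  have hRC : (rcMeasure (fromEdgeSet (↑(F.edgesTouching Ann) : Set (Sym2 V))) p q Annᶜ).real
      {ω | ∃ (x y : V) (w : (fromEdgeSet (E₁ : Set (Sym2 V))).Walk x y), x ∈ C₁ ∧ y ∉ C₁ ∪ Ann ∧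
        (∀ z ∈ w.support, z = x ∨ z = y ∨ z ∈ Ann) ∧ ∀ e ∈ w.edges, e ∈ ω} ≤ 1 - c := by
    haveI := isProbabilityMeasure_rcMeasure
      (fromEdgeSet (↑(F.edgesTouching Ann) : Set (Sym2 V))) hp' hq0 Annᶜ
    exact le_trans (measureReal_mono fun ω hω => F.mem_radCross_of_core_walk_up hE₁' hU₁g hω) hNC
  have hIup : IsUpperSet I₁ := fun ω₁ ω₂ hle h =>
    isUpperSet_openCrossing _ _ _ (Set.inter_subset_inter_left _ hle) h
  have hCE : F.edgesWithin C₁ ⊆ E₁ := F.edgesWithin_mono Set.inter_subset_left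
  have hIdet : ∀ ω₁ ω₂ : BondConfig V,
      (∀ e ∈ E₁, (∀ x ∈ e, x ∈ C₁) → (e ∈ ω₁ ↔ e ∈ ω₂)) → (ω₁ ∈ I₁ ↔ ω₂ ∈ I₁) := by
    intro ω₁ ω₂ h
    have heq : ω₁ ∩ (↑(F.edgesWithin C₁) : Set (Sym2 V)) = ω₂ ∩ ↑(F.edgesWithin C₁) := by
      ext e
      refine ⟨fun he => ⟨?_, he.2⟩, fun he => ⟨?_, he.2⟩⟩
      · exact (h e (hCE he.2) (F.mem_edgesWithin.1 he.2).2).1 he.1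
      · exact (h e (hCE he.2) (F.mem_edgesWithin.1 he.2).2).2 he.1
    rw [hI₁, Set.mem_setOf_eq, Set.mem_setOf_eq, heq]
  -- (A⁺)
  have key := rcMeasure_real_wired_le_free_of_radialBound' hp hq E₁ (F.edgesTouching Ann) C₁ Ann L₁ R'
    hCA hLCA hR'C hcore hEA hc hRC hIup hIdet
  -- the arm read inside the core
  have hbridge : ∀ ω : BondConfig V, ω ⊆ (fromEdgeSet (E₁ : Set (Sym2 V))).edgeSet →
      (ω ∈ openCrossing U₁ R' (U₁ ∩ Q) ↔ ω ∈ I₁) := fun ω hω =>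
    ScaleFrame.inter_mem_openCrossing_core_iff (E' := E₁) Set.inter_subset_left hR'C
      (fun x hx hxQ => ⟨hx, show F.rad x ≤ a * M ^ 4 by
        have : ¬ a * M ^ 3 ≤ F.rad x := hxQ; linarith⟩)
      (fun e he x hx y hy hxU hxQ hyU => ⟨hyU, show F.rad y ≤ a * M ^ 4 by
        have h1 : ¬ a * M ^ 3 ≤ F.rad x := hxQ
        obtain ⟨-, -, h2⟩ := F.rad_of_adj (hE₁' e he).1 hx hy (hU₁g x hxU) (hU₁R x hxU)
        linarith⟩)
      (fun e he heC => Finset.mem_coe.2 (F.mem_edgesWithin.2 ⟨(hE₁' e he).1, heC⟩)) hω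
  have e1 := measureReal_congr
    (rcMeasure_ae_eq_of_forall_subset_edgeSet (fromEdgeSet (E₁ : Set (Sym2 V))) hp' hq0 (R' ∪ L₁)
      hbridge)
  have e2 := measureReal_congr
    (rcMeasure_ae_eq_of_forall_subset_edgeSet (fromEdgeSet (E₁ : Set (Sym2 V))) hp' hq0 R' hbridge)
  -- `Y` is isolated in `⟨E₁⟩`
  have hYI : ∀ v ∈ (Set.toFinite Y).toFinset, ∀ w, ¬ (fromEdgeSet (E₁ : Set (Sym2 V))).Adj v w := by
    intro v hv w hadj
    rw [Set.Finite.mem_toFinset] at hv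
    rw [fromEdgeSet_adj, Finset.mem_coe] at hadj
    have h6 : F.rad v < a * M ^ 6 := ((hE₁' _ hadj.1).2 v (Sym2.mem_mk_left v w)).2
    linarith [hY v hv]
  calc c * (rcMeasure (fromEdgeSet (E₁ : Set (Sym2 V))) p q (R' ∪ L₁)).real
        (openCrossing U₁ R' (U₁ ∩ Q))
      = c * (rcMeasure (fromEdgeSet (E₁ : Set (Sym2 V))) p q (R' ∪ L₁)).real I₁ := by rw [e1]
    _ ≤ (rcMeasure (fromEdgeSet (E₁ : Set (Sym2 V))) p q R').real I₁ := key
    _ = (rcMeasure (fromEdgeSet (E₁ : Set (Sym2 V))) p q R').real (openCrossing U₁ R' (U₁ ∩ Q)) :=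
        e2.symm
    _ ≤ (rcMeasure (fromEdgeSet (↑(F.edgesWithin W) : Set (Sym2 V))) p q
          (R' ∪ ↑(Set.toFinite Y).toFinset)).real (openCrossing U₁ R' (U₁ ∩ Q)) :=
        rcMeasure_real_sub_isolated_le hp hq (F.edgesWithin_mono hU₁W) R' _ hYI
          (isUpperSet_openCrossing _ _ _)
    _ = _ := by rw [Set.Finite.coe_toFinset]

/-- **Outer arm.** Under the no-crossing bound of the collar `(aM^9, aM^10)`, the outer arm event
`A₂ = {rad ≤ aM^11 ↔ Y inside U₂}`, `U₂ = W ∩ {rad > aM^8}`, satisfies `c · g₂ ≤ ν(A₂)` where `g₂` is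
its probability for the edges inside `U₂` with `Y` and the layer `{rad ≤ aM^8 + η}` wired together:
boundary pushing (A⁺) with the core `{rad ≥ aM^10}` (collar crossings reversed), `R'` isolated in
`⟨U₂⟩`. [cite: Kesten1986, §2 eqs. (29)–(30)] -/
theorem arm_outer_lower {p q c a M : ℝ} (hp : p ∈ Set.Ico (0 : ℝ) 1) (hq : 1 ≤ q) (hc : 0 < c)
    (ha : 0 < a) (hM : 4 ≤ M) (hRm : a * M ^ 15 ≤ F.Rmax) (hη : F.η ≤ a)
    (hNC : F.NoCrossBound p q c (a * M ^ 9) (a * M ^ 10)) {W R' Y : Set V}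
    (hW : ∀ v ∈ W, v ∈ F.good ∧ F.rad v < a * M ^ 15) (hYW : Y ⊆ W)
    (hband : ∀ v : V, v ∈ F.good → a < F.rad v → F.rad v < a * M ^ 14 → v ∈ W)
    (hR' : ∀ v ∈ R', F.rad v ≤ a) (hY : ∀ v ∈ Y, a * M ^ 14 - F.η < F.rad v) :
    c * (rcMeasure (fromEdgeSet (↑(F.edgesWithin (W ∩ {v | a * M ^ 8 < F.rad v})) : Set (Sym2 V)))
        p q (Y ∪ {v | F.rad v ≤ a * M ^ 8 + F.η})).real
        (openCrossing (W ∩ {v | a * M ^ 8 < F.rad v})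
          ((W ∩ {v | a * M ^ 8 < F.rad v}) ∩ {v | F.rad v ≤ a * M ^ 11}) Y) ≤
      (rcMeasure (fromEdgeSet (↑(F.edgesWithin W) : Set (Sym2 V))) p q (R' ∪ Y)).real
        (openCrossing (W ∩ {v | a * M ^ 8 < F.rad v})
          ((W ∩ {v | a * M ^ 8 < F.rad v}) ∩ {v | F.rad v ≤ a * M ^ 11}) Y) := by
  obtain ⟨hstep, hak, hmono⟩ := quasiMult_scales ha hM
  have hp' : p ∈ Set.Icc (0 : ℝ) 1 := ⟨hp.1, hp.2.le⟩
  have hq0 : 0 < q := one_pos.trans_le hq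
  have hη0 := F.η_pos
  have s7 : 4 * (a * M ^ 7) ≤ a * M ^ 8 := hstep 7
  have s8 : 4 * (a * M ^ 8) ≤ a * M ^ 9 := hstep 8
  have s9 : 4 * (a * M ^ 9) ≤ a * M ^ 10 := hstep 9
  have s10 : 4 * (a * M ^ 10) ≤ a * M ^ 11 := hstep 10
  have s13 : 4 * (a * M ^ 13) ≤ a * M ^ 14 := hstep 13
  have m7 := hak 7
  have m10_13 := hmono 10 13 (by norm_num)
  have m10_15 := hmono 10 15 (by norm_num)
  have m91 : a * M ^ 9 < a * M ^ 10 := by linarith [hak 9]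
  set U₂ : Set V := W ∩ {v | a * M ^ 8 < F.rad v} with hU₂
  set C₂ : Set V := U₂ ∩ {v | a * M ^ 10 ≤ F.rad v} with hC₂
  set Ann : Set V := F.annSet (a * M ^ 9) (a * M ^ 10) with hAnn
  set L₂ : Set V := {v | F.rad v ≤ a * M ^ 8 + F.η} with hL₂
  set E₂ : Finset (Sym2 V) := F.edgesWithin U₂ with hE₂
  set Q : Set V := {v | F.rad v ≤ a * M ^ 11} with hQ
  set I₂ : Set (BondConfig V) := {ω | ω ∩ ↑(F.edgesWithin C₂) ∈ openCrossing C₂ (C₂ ∩ Q) Y}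
    with hI₂
  have hU₂W : U₂ ⊆ W := Set.inter_subset_left
  have hU₂g : ∀ u ∈ U₂, u ∈ F.good := fun u hu => (hW u hu.1).1
  have hU₂R : ∀ u ∈ U₂, F.rad u < F.Rmax := fun u hu => (hW u hu.1).2.trans_le hRm
  have hE₂' : ∀ e ∈ E₂, e ∈ F.E ∧ ∀ x ∈ e, x ∈ U₂ := fun e he => F.mem_edgesWithin.1 he
  have hYC : Y ⊆ C₂ := fun y hy =>
    ⟨⟨hYW hy, show a * M ^ 8 < F.rad y by linarith [hY y hy, hmono 8 13 (by norm_num)]⟩,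
      show a * M ^ 10 ≤ F.rad y by linarith [hY y hy]⟩
  -- hypotheses of (A⁺)
  have hCA : ∀ v ∈ C₂, v ∉ Ann := fun v hv hvA => absurd hv.2 (not_le.2 hvA.2.2)
  have hLCA : ∀ w ∈ L₂, w ∉ C₂ ∧ w ∉ Ann := fun w hw =>
    ⟨fun h => by have h1 : a * M ^ 10 ≤ F.rad w := h.2; have h2 : F.rad w ≤ a * M ^ 8 + F.η := hw
                 linarith,
     fun h => by have h1 := h.2.1; have h2 : F.rad w ≤ a * M ^ 8 + F.η := hw; linarith⟩
  have hcore : ∀ e ∈ E₂, (∃ v ∈ C₂, v ∈ e) → ∀ x ∈ e, x ∈ C₂ ∨ x ∈ Ann := by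
    rintro e he ⟨v, hv, hve⟩ x hx
    obtain ⟨heE, heU⟩ := hE₂' e he
    obtain ⟨hxg, hx1, -⟩ := F.rad_of_adj heE hve hx (hU₂g v hv.1) (hU₂R v hv.1)
    have hv10 : a * M ^ 10 ≤ F.rad v := hv.2
    by_cases hx10 : a * M ^ 10 ≤ F.rad x
    · exact Or.inl ⟨heU x hx, hx10⟩
    · exact Or.inr ⟨hxg, by linarith, not_le.1 hx10⟩
  have hEA : ∀ e, e ∈ F.edgesTouching Ann ↔ e ∈ E₂ ∧ ∃ v ∈ Ann, v ∈ e := by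
    intro e
    constructor
    · intro he
      obtain ⟨heE, v, hve, hvA⟩ := F.mem_edgesTouching.1 he
      refine ⟨F.mem_edgesWithin.2 ⟨heE, fun x hx => ?_⟩, v, hvA, hve⟩
      obtain ⟨hxg, hx1, hx2⟩ := F.rad_of_mem_edgesTouching_annSet (m10_15.trans hRm) he hx
      exact ⟨hband x hxg (by linarith) (by linarith), show a * M ^ 8 < F.rad x by linarith⟩
    · rintro ⟨he, v, hvA, hve⟩
      exact F.mem_edgesTouching.2 ⟨(hE₂' e he).1, v, hve, hvA⟩
  have hRC : (rcMeasure (fromEdgeSet (↑(F.edgesTouching Ann) : Set (Sym2 V))) p q Annᶜ).real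
      {ω | ∃ (x y : V) (w : (fromEdgeSet (E₂ : Set (Sym2 V))).Walk x y), x ∈ C₂ ∧ y ∉ C₂ ∪ Ann ∧
        (∀ z ∈ w.support, z = x ∨ z = y ∨ z ∈ Ann) ∧ ∀ e ∈ w.edges, e ∈ ω} ≤ 1 - c := by
    haveI := isProbabilityMeasure_rcMeasure
      (fromEdgeSet (↑(F.edgesTouching Ann) : Set (Sym2 V))) hp' hq0 Annᶜ
    exact le_trans (measureReal_mono fun ω hω => F.mem_radCross_of_core_walk_down hE₂' hU₂g m91 hω)
      hNC
  have hIup : IsUpperSet I₂ := fun ω₁ ω₂ hle h =>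
    isUpperSet_openCrossing _ _ _ (Set.inter_subset_inter_left _ hle) h
  have hCE : F.edgesWithin C₂ ⊆ E₂ := F.edgesWithin_mono Set.inter_subset_left
  have hIdet : ∀ ω₁ ω₂ : BondConfig V,
      (∀ e ∈ E₂, (∀ x ∈ e, x ∈ C₂) → (e ∈ ω₁ ↔ e ∈ ω₂)) → (ω₁ ∈ I₂ ↔ ω₂ ∈ I₂) := by
    intro ω₁ ω₂ h
    have heq : ω₁ ∩ (↑(F.edgesWithin C₂) : Set (Sym2 V)) = ω₂ ∩ ↑(F.edgesWithin C₂) := by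
      ext e
      refine ⟨fun he => ⟨?_, he.2⟩, fun he => ⟨?_, he.2⟩⟩
      · exact (h e (hCE he.2) (F.mem_edgesWithin.1 he.2).2).1 he.1
      · exact (h e (hCE he.2) (F.mem_edgesWithin.1 he.2).2).2 he.1
    rw [hI₂, Set.mem_setOf_eq, Set.mem_setOf_eq, heq]
  -- (A⁺)
  have key := rcMeasure_real_wired_le_free_of_radialBound' hp hq E₂ (F.edgesTouching Ann) C₂ Ann L₂ Y
    hCA hLCA hYC hcore hEA hc hRC hIup hIdet
  -- the arm read inside the core (targets swapped, first visit to `Q` from `Y`)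
  have hbridge : ∀ ω : BondConfig V, ω ⊆ (fromEdgeSet (E₂ : Set (Sym2 V))).edgeSet →
      (ω ∈ openCrossing U₂ (U₂ ∩ Q) Y ↔ ω ∈ I₂) := fun ω hω => by
    show ω ∈ openCrossing U₂ (U₂ ∩ Q) Y ↔ ω ∩ ↑(F.edgesWithin C₂) ∈ openCrossing C₂ (C₂ ∩ Q) Y
    rw [ScaleFrame.openCrossing_comm U₂, ScaleFrame.openCrossing_comm C₂]
    exact ScaleFrame.inter_mem_openCrossing_core_iff (E' := E₂) Set.inter_subset_left hYC
      (fun x hx hxQ => ⟨hx, show a * M ^ 10 ≤ F.rad x by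
        have : ¬ F.rad x ≤ a * M ^ 11 := hxQ; linarith⟩)
      (fun e he x hx y hy hxU hxQ hyU => ⟨hyU, show a * M ^ 10 ≤ F.rad y by
        have h1 : ¬ F.rad x ≤ a * M ^ 11 := hxQ
        obtain ⟨-, h2, -⟩ := F.rad_of_adj (hE₂' e he).1 hx hy (hU₂g x hxU) (hU₂R x hxU)
        linarith⟩)
      (fun e he heC => Finset.mem_coe.2 (F.mem_edgesWithin.2 ⟨(hE₂' e he).1, heC⟩)) hω
  have e1 := measureReal_congr
    (rcMeasure_ae_eq_of_forall_subset_edgeSet (fromEdgeSet (E₂ : Set (Sym2 V))) hp' hq0 (Y ∪ L₂)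
      hbridge)
  have e2 := measureReal_congr
    (rcMeasure_ae_eq_of_forall_subset_edgeSet (fromEdgeSet (E₂ : Set (Sym2 V))) hp' hq0 Y hbridge)
  -- `R'` is isolated in `⟨E₂⟩`
  have hRI : ∀ v ∈ (Set.toFinite R').toFinset, ∀ w, ¬ (fromEdgeSet (E₂ : Set (Sym2 V))).Adj v w := by
    intro v hv w hadj
    rw [Set.Finite.mem_toFinset] at hv
    rw [fromEdgeSet_adj, Finset.mem_coe] at hadj
    have h8 : a * M ^ 8 < F.rad v := ((hE₂' _ hadj.1).2 v (Sym2.mem_mk_left v w)).2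
    linarith [hR' v hv, hmono 7 8 (by norm_num)]
  calc c * (rcMeasure (fromEdgeSet (E₂ : Set (Sym2 V))) p q (Y ∪ L₂)).real
        (openCrossing U₂ (U₂ ∩ Q) Y)
      = c * (rcMeasure (fromEdgeSet (E₂ : Set (Sym2 V))) p q (Y ∪ L₂)).real I₂ := by rw [e1]
    _ ≤ (rcMeasure (fromEdgeSet (E₂ : Set (Sym2 V))) p q Y).real I₂ := key
    _ = (rcMeasure (fromEdgeSet (E₂ : Set (Sym2 V))) p q Y).real (openCrossing U₂ (U₂ ∩ Q) Y) :=
        e2.symm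
    _ ≤ (rcMeasure (fromEdgeSet (↑(F.edgesWithin W) : Set (Sym2 V))) p q
          (Y ∪ ↑(Set.toFinite R').toFinset)).real (openCrossing U₂ (U₂ ∩ Q) Y) :=
        rcMeasure_real_sub_isolated_le hp hq (F.edgesWithin_mono hU₂W) Y _ hRI
          (isUpperSet_openCrossing _ _ _)
    _ = _ := by rw [Set.Finite.coe_toFinset, Set.union_comm]

end ScaleFrame

end Literature.Probability.LatticeModels

end
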